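import Literature.NumberTheory.EllipticCurves.PeriodLatticeGamma1QuotientProofs
import HarnessLib

/-!
# THE SHIMURA QUOTIENT `Λ₀(f)/Λ₁(f)` IS A QUOTIENT OF `(ℤ/N)ˣ/{±1}`: `[Λ₀(f) : Λ₁(f)]` IS FINITE AND DIVIDES `φ(N)/2`
Summit `BirchSwinnertonDyer`, route `ManinLocalTwoThree` (cell bsd-f2-manin, es lens, gen 45, turnkey T-es-108; CANDIDATES row E-es-259),
cruxes C2 `ManinOddAtFour` (stmt-BirchSwinnertonDyer-22967) / C3 `ManinPrimeToThreeAtNine` (stmt-22968).  Companion to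
`…ShimuraIndexValues` (T-es-107: the VALUES `5, 4, 2, 2, 3, 2` at `11, 17, 20, 24, 27, 32`); here the A-PRIORI LAW for every
level and every weight-`2` cusp form, which the Literature file `PeriodLatticeGamma1QuotientProofs` names as "NOT here: the
surjectivity `(ℤ/N)ˣ/{±1} ↠ Λ₀/Λ₁` as a map of groups".

PRINTED MATHEMATICS, NEW FORMAL PROOFS (Manin 1972 Thm. 1.6; Stevens 1989 §2; Ling–Oesterlé 1991 §1); fact-free; standard
axioms.  `Λ₀(f) = periodLattice f` (periods over `Γ₀(N)`), `Λ₁(f) = periodLatticeGamma1 f`, and the index is Mathlib's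
`(periodLatticeGamma1 f).relIndex (periodLattice f) = [Λ₀(f) : Λ₀(f) ∩ Λ₁(f)]`.

* `exists_unitsHom_surjective` — **the class map** `(ℤ/N)ˣ ↠ Λ₀(f)/Λ₁(f)`, `u ↦ [{∞, γ_u∞}_f]` (`d_{γ_u} ≡ u`), is a
  well-defined SURJECTIVE HOMOMORPHISM killing `−1`: well-defined because the class of `{∞, γ∞}_f` depends only on
  `d_γ mod N` (tree `cuspSymbol_sub_mem_periodLatticeGamma1_of_apply_eq`), a homomorphism by Manin's `{∞, γδ∞} = {∞, γ∞} +
  {∞, δ∞}` (tree `cuspSymbol_mul_holds`) and `d_{γδ} ≡ d_γ d_δ` (`Gamma0Map`), onto because every unit is a `d_γ` (tree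
  `exists_gamma0_apply_one_one_eq_of_isUnit`) and every period is a cusp symbol (tree `coe_periodLattice_eq_range`), and
  `−1 ↦ 0` (tree `cuspSymbol_mem_periodLatticeGamma1_of_apply_eq_neg_one`).
* `relIndex_dvd_totient` — **`[Λ₀(f) : Λ₁(f)] ∣ φ(N)`**; `relIndex_ne_zero` — the Shimura quotient is FINITE (for every `f`,
  with no appeal to the finite generation of `Γ₀(N)` or to `Λ₀(f)` being a lattice);
  `two_mul_relIndex_dvd_totient` / `relIndex_dvd_totient_div_two` — **`2·[Λ₀(f) : Λ₁(f)] ∣ φ(N)`** for `N > 2`.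
* Consistency with the typed values: `φ(11)/2 = 5`, `φ(17)/2 = 8 ⊇ 4`, `φ(20)/2 = 4 ⊇ 2`, `φ(24)/2 = 4 ⊇ 2`, `φ(27)/2 = 9 ⊇ 3`,
  `φ(32)/2 = 8 ⊇ 2`, `φ(36)/2 = 6 ⊇ 1`, `φ(52)/2 = 12 ⊇ 2` (E15-LATTICE-INDEX-v1); at a prime level `p` the law reads
  `[Λ₀ : Λ₁] ∣ (p − 1)/2` (`relIndex_dvd_of_prime`), Mazur's `n = num((p−1)/12)` being the sharp value for newform data.

STATUS: C2/C3 remain OPEN ⟸ CDT; this file is structural (it bounds the Shimura device, it does not decide `c`).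
-/

noncomputable section

set_option linter.dupNamespace false

open scoped Classical MatrixGroups

open CongruenceSubgroup Matrix.SpecialLinearGroup ModularGroup
open Literature.NumberTheory.EllipticCurves Literature.NumberTheory.EllipticCurves.ModularForms

namespace Summit.BirchSwinnertonDyer.BirchSwinnertonDyer.Theorems.ManinLocalTwoThree.ShimuraIndex

variable {N : ℕ} [NeZero N] (f : CuspForm (Gamma0 N) 2)

/-- **THE CLASS MAP `(ℤ/N)ˣ ↠ Λ₀(f)/Λ₁(f)`** (`u ↦` the class of `{∞, γ∞}_f` for any `γ ∈ Γ₀(N)` with `d_γ ≡ u`): a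
surjective group homomorphism (written multiplicatively) with `−1 ↦ 0`, whose value on `d_γ` is the class of `{∞, γ∞}_f`.
[cite: Manin1972, Thm. 1.6] [cite: Stevens1989, §2] [cite: LingOesterle1991, §1] -/
theorem exists_unitsHom_surjective :
    ∃ Φ : (ZMod N)ˣ →* Multiplicative (periodLattice f ⧸ (periodLatticeGamma1 f).addSubgroupOf (periodLattice f)),
      Function.Surjective Φ ∧
      (∀ γ : Gamma0 N, Φ (isUnit_apply_one_one γ).unit =
        Multiplicative.ofAdd (QuotientAddGroup.mk' _ ⟨cuspSymbol f γ, cuspSymbol_mem_periodLattice f γ⟩)) ∧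
      Φ (-1) = 1 := by
  set H : AddSubgroup (periodLattice f) := (periodLatticeGamma1 f).addSubgroupOf (periodLattice f) with hH
  -- a section `u ↦ γ_u` of `γ ↦ d_γ`
  have hsec : ∀ u : (ZMod N)ˣ, ∃ γ : Gamma0 N, (((γ : SL(2, ℤ)) 1 1 : ℤ) : ZMod N) = u := fun u ↦
    exists_gamma0_apply_one_one_eq_of_isUnit u.isUnit
  choose g hg using hsec
  -- the class of a cusp symbol
  set cl : Gamma0 N → periodLattice f ⧸ H := fun γ ↦
    QuotientAddGroup.mk' H ⟨cuspSymbol f γ, cuspSymbol_mem_periodLattice f γ⟩ with hcl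
  have hcl_eq : ∀ γ δ : Gamma0 N, (((γ : SL(2, ℤ)) 1 1 : ℤ) : ZMod N) = (((δ : SL(2, ℤ)) 1 1 : ℤ) : ZMod N) →
      cl γ = cl δ := fun γ δ hd ↦ by
    show QuotientAddGroup.mk' H ⟨cuspSymbol f γ, cuspSymbol_mem_periodLattice f γ⟩ =
      QuotientAddGroup.mk' H ⟨cuspSymbol f δ, cuspSymbol_mem_periodLattice f δ⟩
    rw [← sub_eq_zero, ← map_sub, QuotientAddGroup.mk'_apply, QuotientAddGroup.eq_zero_iff,
      AddSubgroup.mem_addSubgroupOf]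
    exact cuspSymbol_sub_mem_periodLatticeGamma1_of_apply_eq f δ γ hd.symm
  have hcl_mul : ∀ γ δ : Gamma0 N, cl (γ * δ) = cl γ + cl δ := fun γ δ ↦ by
    show QuotientAddGroup.mk' H ⟨cuspSymbol f (γ * δ), cuspSymbol_mem_periodLattice f (γ * δ)⟩ =
      QuotientAddGroup.mk' H ⟨cuspSymbol f γ, cuspSymbol_mem_periodLattice f γ⟩ +
        QuotientAddGroup.mk' H ⟨cuspSymbol f δ, cuspSymbol_mem_periodLattice f δ⟩
    rw [← map_add]
    exact congrArg (QuotientAddGroup.mk' H) (Subtype.ext (cuspSymbol_mul_holds f γ δ))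
  refine ⟨MonoidHom.mk' (fun u ↦ Multiplicative.ofAdd (cl (g u))) fun u v ↦ ?_, fun q ↦ ?_, fun γ ↦ ?_, ?_⟩
  · -- multiplicativity: `d_{γ_{uv}} ≡ uv ≡ d_{γ_u} d_{γ_v} ≡ d_{γ_u γ_v}`
    rw [← ofAdd_add, ← hcl_mul]
    congr 1
    refine hcl_eq _ _ ?_
    have hmul : ((((g u * g v : Gamma0 N) : SL(2, ℤ)) 1 1 : ℤ) : ZMod N) =
        (((g u : SL(2, ℤ)) 1 1 : ℤ) : ZMod N) * (((g v : SL(2, ℤ)) 1 1 : ℤ) : ZMod N) := map_mul (Gamma0Map N) (g u) (g v)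
    rw [hmul, hg, hg, hg, Units.val_mul]
  · -- surjectivity: every period is a cusp symbol `{∞, γ∞}_f`, hit by `u = d_γ`
    obtain ⟨z, hzq⟩ := QuotientAddGroup.mk'_surjective H (Multiplicative.toAdd q)
    have hz : (z : ℂ) ∈ (periodLattice f : Set ℂ) := z.2
    rw [coe_periodLattice_eq_range] at hz
    obtain ⟨γ, hγ⟩ := hz
    have hzeq : (⟨cuspSymbol f γ, cuspSymbol_mem_periodLattice f γ⟩ : periodLattice f) = z := Subtype.ext hγ
    refine ⟨(isUnit_apply_one_one γ).unit, ?_⟩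
    show Multiplicative.ofAdd (cl (g _)) = q
    rw [hcl_eq (g _) γ (by rw [hg, IsUnit.unit_spec])]
    show Multiplicative.ofAdd (QuotientAddGroup.mk' H ⟨cuspSymbol f γ, cuspSymbol_mem_periodLattice f γ⟩) = q
    rw [hzeq, hzq]
    exact ofAdd_toAdd q
  · show Multiplicative.ofAdd (cl (g _)) = _
    rw [hcl_eq (g _) γ (by rw [hg, IsUnit.unit_spec])]
  · show Multiplicative.ofAdd (cl (g (-1))) = 1
    rw [← ofAdd_zero]
    refine congrArg Multiplicative.ofAdd ?_
    show QuotientAddGroup.mk' H ⟨cuspSymbol f (g (-1)), cuspSymbol_mem_periodLattice f (g (-1))⟩ = 0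
    rw [QuotientAddGroup.mk'_apply, QuotientAddGroup.eq_zero_iff, AddSubgroup.mem_addSubgroupOf]
    exact cuspSymbol_mem_periodLatticeGamma1_of_apply_eq_neg_one f _ (by rw [hg, Units.val_neg, Units.val_one])

/-- **`[Λ₀(f) : Λ₁(f)] ∣ φ(N)`** for every level `N` and every weight-`2` cusp form `f` on `Γ₀(N)`.
[cite: LingOesterle1991, §1] [cite: Stevens1989, §2] -/
theorem relIndex_dvd_totient : (periodLatticeGamma1 f).relIndex (periodLattice f) ∣ Nat.totient N := by
  obtain ⟨Φ, hΦ, -, -⟩ := exists_unitsHom_surjective f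
  have h := Subgroup.card_dvd_of_surjective Φ hΦ
  rwa [Nat.card_eq_fintype_card (α := (ZMod N)ˣ), ZMod.card_units_eq_totient] at h

/-- **The Shimura quotient is finite**: `[Λ₀(f) : Λ₁(f)] ≠ 0` (Mathlib's convention `index = 0` for infinite index).
[cite: LingOesterle1991, §1] -/
theorem relIndex_ne_zero : (periodLatticeGamma1 f).relIndex (periodLattice f) ≠ 0 := fun h ↦
  (Nat.totient_pos.mpr (NeZero.pos N)).ne' (Nat.eq_zero_of_zero_dvd (h ▸ relIndex_dvd_totient f))

/-- **`2·[Λ₀(f) : Λ₁(f)] ∣ φ(N)` for `N > 2`**: the class map kills `±1`, a subgroup of order `2` of `(ℤ/N)ˣ` when `N > 2`.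
[cite: LingOesterle1991, §1] -/
theorem two_mul_relIndex_dvd_totient (hN : 2 < N) : 2 * (periodLatticeGamma1 f).relIndex (periodLattice f) ∣ Nat.totient N := by
  obtain ⟨Φ, hΦ, -, hneg⟩ := exists_unitsHom_surjective f
  have hker : (-1 : (ZMod N)ˣ) ∈ Φ.ker := hneg
  have hord : orderOf (⟨-1, hker⟩ : Φ.ker) = 2 := by
    haveI : Fact (2 < N) := ⟨hN⟩
    rw [Subgroup.orderOf_mk]
    refine orderOf_eq_prime (by simp) fun h ↦ ZMod.neg_one_ne_one (n := N) ?_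
    have := congrArg (fun u : (ZMod N)ˣ ↦ (u : ZMod N)) h
    simpa using this
  have h2 : 2 ∣ Nat.card Φ.ker := hord ▸ orderOf_dvd_natCard _
  have hindex : Φ.ker.index = (periodLatticeGamma1 f).relIndex (periodLattice f) := by
    rw [Subgroup.index_eq_card, Nat.card_congr (QuotientGroup.quotientKerEquivOfSurjective Φ hΦ).toEquiv]
    rfl
  rw [← ZMod.card_units_eq_totient, ← Nat.card_eq_fintype_card, ← Φ.ker.card_mul_index, hindex]
  exact mul_dvd_mul h2 dvd_rfl

/-- **`[Λ₀(f) : Λ₁(f)] ∣ φ(N)/2` for `N > 2`.** [cite: LingOesterle1991, §1] -/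
theorem relIndex_dvd_totient_div_two (hN : 2 < N) : (periodLatticeGamma1 f).relIndex (periodLattice f) ∣ Nat.totient N / 2 :=
  Nat.dvd_div_of_mul_dvd (two_mul_relIndex_dvd_totient f hN)

/-- **Prime level**: `[Λ₀(f) : Λ₁(f)] ∣ (p − 1)/2` for `f` on `Γ₀(p)`, `p` an odd prime (`φ(p) = p − 1`); e.g. `∣ 5` at `p = 11`
(value `5`, `…ShimuraIndexValues`), `∣ 8` at `17` (value `4`), `∣ 9` at `19` (value `3`), `∣ 18` at `37` (value `1` for both
newforms, E15): the law bounds, Mazur's `n = num((p − 1)/12)` is the sharp order of the Shimura subgroup.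
[cite: Mazur1977, II.(11.6) and (17.10)] [cite: LingOesterle1991, §1] -/
theorem relIndex_dvd_of_prime {p : ℕ} [NeZero p] (hp : p.Prime) (hp2 : p ≠ 2) (g : CuspForm (Gamma0 p) 2) :
    (periodLatticeGamma1 g).relIndex (periodLattice g) ∣ (p - 1) / 2 := by
  have h := relIndex_dvd_totient_div_two g (lt_of_le_of_ne hp.two_le (Ne.symm hp2))
  rwa [Nat.totient_prime hp] at h

end Summit.BirchSwinnertonDyer.BirchSwinnertonDyer.Theorems.ManinLocalTwoThree.ShimuraIndex
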